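import Literature.AlgebraicGeometry.Modules.CechResolution
import Literature.AlgebraicGeometry.Modules.SheafHom
import HarnessLib

/-!
# Čech cocycles of local homomorphisms and their `Ext`-classes; refinement

For a scheme `X`, a family of opens `𝓤 = (U_i)_{i ∈ ι}` and `𝒪_X`-modules `E`, `M`, an
**`n`-cochain of local homomorphisms** is a family `ω = (ω_α : E|_{U_α} → M|_{U_α})_α`
(`Cech.LocalFamily`; e.g. `M = E`: a Čech cochain with values in `𝓔nd(E)` in the twisted, frame-free
form). It defines the morphism `ω♯ : E → Čⁿ(𝓤, M)`, `s ↦ (ω_α(s|_{U_α}))_α` (`Cech.familyHom`), and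
the Čech differential of families `dω` (`Cech.dFamily`, `(dω)_α = Σ_k (-1)^k ω_{α∘δ_k}|_{U_α}`)
satisfies `ω♯ ≫ d = (dω)♯` (`familyHom_comp_d`). Hence a COCYCLE (`dω = 0`) has an `Ext`-class

  `Cech.classOf a ω ∈ Extⁿ(E, M)`  (`= θ(ω♯)` for an exact augmentation `a` of `Č•(𝓤, M)`,
  `IteratedExtClass.lean`; for a cover, `a = Cech.exactAugmentation`),

which vanishes on coboundaries `ω = dβ` (`classOf_eq_zero_of_eq_dFamily`) — the classical map
`Ȟⁿ(𝓤, 𝓗om(E, M)) → Extⁿ(E, M)` (Godement II.5.9, Hartshorne III.4.4) in the form needed for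
obstruction classes. **Refinement** (same index set, `V_i ≤ U_i`): the restriction chain map
`Č•(𝓤, M) → Č•(𝓥, M)` (`Cech.refine`) commutes with the augmentations, so the class of a cocycle
equals the class of its restriction (`classOf_restrictFamily`).

## References

* R. Godement, *Topologie algébrique et théorie des faisceaux* (1958), II.5.9.
* R. Hartshorne, *Algebraic Geometry*, GTM 52 (1977), III.4, Lemma 4.4. [Hartshorne1977]
-/

noncomputable section

universe u

open CategoryTheory CategoryTheory.Abelian AlgebraicGeometry Opposite TopologicalSpace Limits

namespace Literature.AlgebraicGeometry.Modules

namespace Cech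

variable {X : Scheme.{u}} {ι : Type u} (U : ι → X.Opens)

/-! ### Cochains of local homomorphisms -/

/-- An `n`-cochain of local homomorphisms `(ω_α : E|_{U_α} → M|_{U_α})_{α : Fin (n+1) → ι}`.
[folklore] -/
abbrev LocalFamily (n : ℕ) (E M : X.Modules) : Type u :=
  ∀ α : Fin (n + 1) → ι, E.over (face U α) ⟶ M.over (face U α)

variable {U} {n : ℕ} {E M : X.Modules}

/-- **The morphism `ω♯ : E → Čⁿ(𝓤, M)` of a cochain of local homomorphisms**:
`s ↦ (ω_α(s|_{V ⊓ U_α}))_α`. [folklore] -/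
def familyHom (ω : LocalFamily U n E M) : E ⟶ obj U n M :=
  homMk (fun V s α => appLE (ω α) (homOfLE inf_le_right) (res E inf_le_left s))
    (fun _ _ _ => funext fun _ => by rw [map_add, appLE_add_right]; rfl)
    (fun _ _ _ => funext fun _ => by rw [res_smul, appLE_smul_right]; rfl)
    (fun V W i s => funext fun α => by
      rw [restrict_apply]
      change appLE (ω α) _ (res E _ (res E i.le s)) = _
      rw [res_res, ← res_res (inf_le_left : V ⊓ face U α ≤ V) (inf_le_inf_right (face U α) i.le)]
      exact appLE_map (ω α) (homOfLE inf_le_right) (homOfLE (inf_le_inf_right (face U α) i.le)) _)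

/-- Components of `ω♯`. [folklore] -/
@[simp] lemma familyHom_app_apply (ω : LocalFamily U n E M) (V : X.Opens) (s : Γ(E, V))
    (α : Fin (n + 1) → ι) :
    ((familyHom ω).app V s : Sections U n M V) α =
      appLE (ω α) (homOfLE inf_le_right) (res E inf_le_left s) := rfl

/-- `ω ↦ ω♯` is additive. [folklore] -/
lemma familyHom_add (ω ω' : LocalFamily U n E M) :
    familyHom (ω + ω') = familyHom ω + familyHom ω' :=
  hom_ext_to fun _ _ _ => rfl

/-- `0♯ = 0`. [folklore] -/
@[simp] lemma familyHom_zero : familyHom (0 : LocalFamily U n E M) = 0 :=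
  hom_ext_to fun _ _ _ => by rw [familyHom_app_apply]; rfl

/-- **The Čech differential of a cochain of local homomorphisms**:
`(dω)_α = Σ_k (-1)^k ω_{α ∘ δ_k}|_{U_α}`. [folklore] -/
def dFamily (ω : LocalFamily U n E M) : LocalFamily U (n + 1) E M := fun α =>
  ∑ k : Fin (n + 2), (-1 : ℤ) ^ (k : ℕ) •
    restrictHom (homOfLE (face_le_face_comp U α (Fin.succAbove k))) (ω (α ∘ Fin.succAbove k))

/-- `d` of families is additive. [folklore] -/
lemma dFamily_add (ω ω' : LocalFamily U n E M) : dFamily (ω + ω') = dFamily ω + dFamily ω' := by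
  funext α
  simp only [dFamily, Pi.add_apply, restrictHom_add, smul_add, Finset.sum_add_distrib]

/-- Values of an integer multiple of a local homomorphism. [folklore] -/
lemma appLE_zsmul {W V : X.Opens} (k : ℤ) (φ : E.over W ⟶ M.over W) (l : V ⟶ W) (s : Γ(E, V)) :
    appLE (k • φ) l s = k • appLE φ l s :=
  map_zsmul (appLEHom l s) k φ

/-- **`ω♯ ≫ d = (dω)♯`.** [folklore] -/
theorem familyHom_comp_d (ω : LocalFamily U n E M) :
    familyHom ω ≫ d U M n = familyHom (dFamily ω) := by
  refine hom_ext_to fun V s α => ?_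
  rw [Scheme.Modules.Hom.comp_app, CategoryTheory.comp_apply, d_app_apply, familyHom_app_apply,
    dFamily, appLE_sum]
  refine Finset.sum_congr rfl fun k _ => ?_
  rw [familyHom_app_apply, appLE_zsmul, appLE_restrictHom]
  congr 1
  rw [← res_res (inf_le_left : V ⊓ face U (α ∘ Fin.succAbove k) ≤ V)
    (inf_le_inf_left V (face_le_face_comp U α (Fin.succAbove k)))]
  exact (appLE_map (ω (α ∘ Fin.succAbove k)) (homOfLE inf_le_right) (homOfLE _) _).symm

/-- A cocycle of local homomorphisms gives a cocycle `ω♯` of the Čech complex. [folklore] -/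
theorem familyHom_comp_d_eq_zero (ω : LocalFamily U n E M) (hω : dFamily ω = 0) :
    familyHom ω ≫ (complex U M).d n (n + 1) = 0 := by
  have h : familyHom ω ≫ d U M n = 0 := by rw [familyHom_comp_d, hω, familyHom_zero]
  rw [complex_d]
  exact h

/-! ### The `Ext`-class of a cocycle of local homomorphisms -/

variable [HasExt.{u + 1} X.Modules]

/-- **The `Ext`-class `[ω] ∈ Extⁿ(E, M)` of a cocycle of local homomorphisms** with respect to an
exact augmentation `a` of `Č•(𝓤, M)` by `M`: `θ(ω♯)` (`IteratedExtClass.lean`).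
[cite: Hartshorne1977, III Lemma 4.4] -/
def classOf (a : Literature.Algebra.Homology.ExactAugmentation (complex U M) M)
    (ω : LocalFamily U n E M) (hω : dFamily ω = 0) : Ext E M n :=
  a.theta (familyHom ω) (familyHom_comp_d_eq_zero ω hω)

/-- Unfolding `classOf`. [folklore] -/
lemma classOf_def (a : Literature.Algebra.Homology.ExactAugmentation (complex U M) M)
    (ω : LocalFamily U n E M) (hω : dFamily ω = 0) :
    classOf a ω hω = a.theta (familyHom ω) (familyHom_comp_d_eq_zero ω hω) := rfl

/-- **Coboundaries have zero class**: `[dβ] = 0`. [cite: Hartshorne1977, III Lemma 4.4] -/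
theorem classOf_eq_zero_of_eq_dFamily (a : Literature.Algebra.Homology.ExactAugmentation (complex U M) M)
    (β : LocalFamily U n E M) (ω : LocalFamily U (n + 1) E M) (hω : dFamily ω = 0)
    (h : ω = dFamily β) : classOf a ω hω = 0 :=
  a.theta_eq_zero_of_boundary (familyHom β) _ _ (by
    rw [complex_d, h]
    exact (familyHom_comp_d β).symm)

/-- The class is additive. [folklore] -/
theorem classOf_add (a : Literature.Algebra.Homology.ExactAugmentation (complex U M) M)
    (ω ω' : LocalFamily U n E M) (hω : dFamily ω = 0) (hω' : dFamily ω' = 0) :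
    classOf a (ω + ω') (by rw [dFamily_add, hω, hω', add_zero]) = classOf a ω hω + classOf a ω' hω' := by
  simp only [classOf_def]
  rw [← a.theta_add]
  exact a.theta_congr (familyHom_add ω ω') _ _

/-- The class does not depend on the cocycle proof, and equal cocycles have equal classes.
[folklore] -/
theorem classOf_congr (a : Literature.Algebra.Homology.ExactAugmentation (complex U M) M)
    {ω ω' : LocalFamily U n E M} (h : ω = ω') (hω : dFamily ω = 0) (hω' : dFamily ω' = 0) :
    classOf a ω hω = classOf a ω' hω' := by
  subst h; rfl



/-- The class of the zero cochain vanishes. [folklore] -/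
@[simp] theorem classOf_zero (a : Literature.Algebra.Homology.ExactAugmentation (complex U M) M)
    (h : dFamily (0 : LocalFamily U n E M) = 0) : classOf a (0 : LocalFamily U n E M) h = 0 := by
  rw [classOf_def]
  have h0 : familyHom (0 : LocalFamily U n E M) = 0 := familyHom_zero
  rw [a.theta_congr h0 _ (by exact zero_comp)]
  exact a.theta_zero _

/-- **Cohomologous cocycles have the same class**: if `ω' = ω + dλ` then `[ω'] = [ω]`.
[cite: Hartshorne1977, III Lemma 4.4] -/
theorem classOf_eq_of_eq_add_dFamily (a : Literature.Algebra.Homology.ExactAugmentation (complex U M) M)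
    {ω ω' : LocalFamily U (n + 1) E M} (lam : LocalFamily U n E M) (hω : dFamily ω = 0)
    (hω' : dFamily ω' = 0) (h : ω' = ω + dFamily lam) : classOf a ω' hω' = classOf a ω hω := by
  have hd : dFamily (dFamily lam) = 0 := by
    have h1 : dFamily ω' = dFamily ω + dFamily (dFamily lam) := by rw [h, dFamily_add]
    rw [hω, hω', zero_add] at h1
    exact h1.symm
  rw [classOf_congr a h hω' (by rw [dFamily_add, hω, hd, add_zero]), classOf_add a ω (dFamily lam) hω hd,
    classOf_eq_zero_of_eq_dFamily a lam (dFamily lam) hd rfl, add_zero]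

/-! ### Refinement with the same index set -/

omit [HasExt.{u + 1} X.Modules]

section Refine

variable {V : ι → X.Opens} (hVU : ∀ i, V i ≤ U i)

include hVU in
/-- Faces are monotone in the family of opens. [folklore] -/
lemma face_mono {m : ℕ} (α : Fin (m + 1) → ι) : face V α ≤ face U α :=
  iInf_mono fun k => hVU (α k)

variable (M)

/-- **The refinement map `Čⁿ(𝓤, M) → Čⁿ(𝓥, M)`** for `V_i ≤ U_i`: restriction of each component.
[folklore] -/
def refine (m : ℕ) : obj U m M ⟶ obj V m M :=
  homMk (fun W s α => res M (inf_le_inf_left W (face_mono hVU α)) ((s : Sections U m M W) α))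
    (fun _ s t => funext fun α => by rw [obj_add_apply, map_add]; rfl)
    (fun _ r s => funext fun α => by rw [obj_smul_apply, res_smul, resO_resO]; rfl)
    (fun _ _ i s => funext fun α => by rw [obj_map_apply, res_res, restrict_apply, res_res])

/-- Components of the refinement map. [folklore] -/
@[simp] lemma refine_app_apply (m : ℕ) (W : X.Opens) (s : Γ(obj U m M, W)) (α : Fin (m + 1) → ι) :
    ((refine M hVU m).app W s : Sections V m M W) α =
      res M (inf_le_inf_left W (face_mono hVU α)) ((s : Sections U m M W) α) := rfl

/-- Refinement commutes with the structure maps. [folklore] -/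
lemma structMap_refine {l m : ℕ} (g : Fin (l + 1) → Fin (m + 1)) :
    structMap U m M g ≫ refine M hVU m = refine M hVU l ≫ structMap V m M g :=
  hom_ext_to fun W s α => by
    simp only [Scheme.Modules.Hom.comp_app, CategoryTheory.comp_apply, refine_app_apply,
      structMap_app_apply, res_res]

/-- Refinement commutes with the Čech differentials. [folklore] -/
lemma d_refine (m : ℕ) : d U M m ≫ refine M hVU (m + 1) = refine M hVU m ≫ d V M m := by
  rw [d, d, Preadditive.sum_comp, Preadditive.comp_sum]
  refine Finset.sum_congr rfl fun k _ => ?_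
  rw [Preadditive.zsmul_comp, Preadditive.comp_zsmul, structMap_refine]

/-- **The refinement chain map `Č•(𝓤, M) → Č•(𝓥, M)`.** [folklore] -/
def refineChainMap : complex U M ⟶ complex V M where
  f m := refine M hVU m
  comm' m m' h := by
    cases h
    rw [complex_d, complex_d]
    exact (d_refine M hVU m).symm

/-- Refinement commutes with the augmentations. [folklore] -/
lemma augment_refine : augment U M ≫ refine M hVU 0 = augment V M :=
  hom_ext_to fun W s α => by
    rw [Scheme.Modules.Hom.comp_app, CategoryTheory.comp_apply, refine_app_apply,
      augment_app_apply, augment_app_apply, res_res]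

variable {M}

/-- Restriction of local homomorphisms as an additive map. [folklore] -/
def restrictAddHom {W W' : X.Opens} (i : W' ⟶ W) : (E.over W ⟶ M.over W) →+ (E.over W' ⟶ M.over W') where
  toFun := restrictHom i
  map_zero' := restrictHom_zero i
  map_add' := restrictHom_add i

/-- Restriction of a finite sum of local homomorphisms. [folklore] -/
lemma restrictHom_finset_sum {W W' : X.Opens} (i : W' ⟶ W) {κ : Type*} (t : Finset κ)
    (φ : κ → (E.over W ⟶ M.over W)) :
    restrictHom i (∑ k ∈ t, φ k) = ∑ k ∈ t, restrictHom i (φ k) :=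
  map_sum (restrictAddHom i) φ t

/-- Restriction of an integer multiple of a local homomorphism. [folklore] -/
lemma restrictHom_zsmul {W W' : X.Opens} (i : W' ⟶ W) (k : ℤ) (φ : E.over W ⟶ M.over W) :
    restrictHom i (k • φ) = k • restrictHom i φ :=
  map_zsmul (restrictAddHom i) k φ

/-- Restriction does not depend on the name of the inclusion. [folklore] -/
lemma restrictHom_congr {W W' : X.Opens} (i i' : W' ⟶ W) (φ : E.over W ⟶ M.over W) :
    restrictHom i φ = restrictHom i' φ := by
  rw [Subsingleton.elim i i']

/-- Restriction of a cochain of local homomorphisms to the refined family of opens. [folklore] -/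
def restrictFamily (ω : LocalFamily U n E M) : LocalFamily V n E M :=
  fun α => restrictHom (homOfLE (face_mono hVU α)) (ω α)

/-- `(ω|_𝓥)♯ = ω♯ ≫ refine`. [folklore] -/
theorem familyHom_restrictFamily (ω : LocalFamily U n E M) :
    familyHom (restrictFamily hVU ω) = familyHom ω ≫ refine M hVU n := by
  refine hom_ext_to fun W s α => ?_
  rw [familyHom_app_apply, Scheme.Modules.Hom.comp_app, CategoryTheory.comp_apply,
    refine_app_apply, familyHom_app_apply, restrictFamily, appLE_restrictHom,
    ← res_res (inf_le_left : W ⊓ face U α ≤ W) (inf_le_inf_left W (face_mono hVU α))]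
  exact appLE_map (ω α) (homOfLE inf_le_right) (homOfLE _) _

/-- Restriction of families commutes with the Čech differential. [folklore] -/
theorem dFamily_restrictFamily (ω : LocalFamily U n E M) :
    dFamily (restrictFamily hVU ω) = restrictFamily hVU (dFamily ω) := by
  funext α
  simp only [dFamily, restrictFamily, restrictHom_finset_sum, restrictHom_zsmul]
  refine Finset.sum_congr rfl fun k _ => ?_
  rw [← restrictHom_comp', ← restrictHom_comp']
  exact congrArg ((-1 : ℤ) ^ (k : ℕ) • ·) (restrictHom_congr _ _ _)

/-- A restricted cocycle is a cocycle. [folklore] -/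
theorem dFamily_restrictFamily_eq_zero (ω : LocalFamily U n E M) (hω : dFamily ω = 0) :
    dFamily (restrictFamily hVU ω) = 0 := by
  rw [dFamily_restrictFamily, hω]
  funext α
  exact restrictHom_zero _

variable [HasExt.{u + 1} X.Modules]

/-- **The class of a cocycle equals the class of its restriction to a refinement** (both computed
with exact augmentations compatible with `Cech.augment`). [cite: Hartshorne1977, III Lemma 4.4] -/
theorem classOf_restrictFamily (a : Literature.Algebra.Homology.ExactAugmentation (complex U M) M)
    (a' : Literature.Algebra.Homology.ExactAugmentation (complex V M) M)
    (ha : a.ε = augment U M) (ha' : a'.ε = augment V M)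
    (ω : LocalFamily U n E M) (hω : dFamily ω = 0) :
    classOf a' (restrictFamily hVU ω) (dFamily_restrictFamily_eq_zero hVU ω hω) = classOf a ω hω := by
  rw [classOf_def, classOf_def]
  have hμ : a.ε ≫ (refineChainMap M hVU).f 0 = 𝟙 M ≫ a'.ε := by
    rw [ha, ha', Category.id_comp]; exact augment_refine M hVU
  have h := a.theta_comp_map a' (refineChainMap M hVU) (𝟙 M) hμ (familyHom ω)
    (familyHom_comp_d_eq_zero ω hω)
    (Literature.Algebra.Homology.ExactAugmentation.comp_f_d_eq_zero _ _ (familyHom_comp_d_eq_zero ω hω))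
  rw [Ext.comp_mk₀_id] at h
  rw [← h]
  exact a'.theta_congr (familyHom_restrictFamily hVU ω) _ _

end Refine

end Cech

end Literature.AlgebraicGeometry.Modules

end
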